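import Literature.AlgebraicGeometry.Resolution.PrincipalizationToResolution
import HarnessLib

/-!
# Route CleanCovers — crux `CoverResolution` (stmt-ResolutionOfSingularities-15104), line
# `strategy-split`: the finite-cover induction over a field (`stub_coverInductionOverField`)

For a quasi-compact integral scheme `X`: if every point of `X` has an open neighbourhood admitting
a resolution of singularities (`hloc`), and for every integral open subscheme `W` of `X` the union
of two resolvable opens covering `W` is resolvable (`hbin`), then `X` has a resolution.

Proof (Hu 2021, p. 65: "it remains to glue finitely many local resolutions"). `X` is
quasi-compact, so finitely many resolvable opens `U x₁, …, U xₙ` cover it. By induction over the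
(nonempty) finite index set, `U x₁ ∪ ⋯ ∪ U x_k` is resolvable: the step applies `hbin` to the open
subscheme `W = U a ∪ (U x₁ ∪ ⋯ ∪ U x_k)` of `X` — a nonempty open of the integral `X`, hence
integral — and to its two opens `W.ι ⁻¹ (U a)`, `W.ι ⁻¹ (U x₁ ∪ ⋯ ∪ U x_k)`, which are resolvable
because resolutions transport along the open immersions `W.ι ∣_ _`
(`Scheme.HasResolution.of_isOpenImmersion`). Finally `U x₁ ∪ ⋯ ∪ U xₙ = ⊤ ≅ X`
(`Scheme.HasResolution.of_iso` along `X.topIso`). Same shape as `Theorems.stub_coverInduction`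
(route UniversalCells), with the binary hypothesis localised to the opens of the fixed `X`.
-/

-- single-problem summit: the doubled namespace component `ResolutionOfSingularities` is forced
set_option linter.dupNamespace false

noncomputable section

namespace Summit.ResolutionOfSingularities.ResolutionOfSingularities.Theorems

open CategoryTheory AlgebraicGeometry TopologicalSpace Literature.AlgebraicGeometry.Resolution

/-- **Finite-cover induction over a field** (crux `CleanCovers.CoverResolution`, line
`strategy-split`, stub `stub_coverInductionOverField`): a quasi-compact integral scheme `X` every
point of which has a resolvable open neighbourhood (`hloc`), and in which two resolvable opens
covering an integral open subscheme `W` patch to a resolution of `W` (`hbin`), has a resolution: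
a finite subcover by resolvable opens (quasi-compactness) and induction on its size, the step being
`hbin` applied to the open subscheme `U a ∪ (U x₁ ∪ ⋯ ∪ U x_k)`. [cite: Hu2021, p. 65] -/
theorem stub_coverInductionOverField : ∀ (X : AlgebraicGeometry.Scheme.{0}), CompactSpace X →
    AlgebraicGeometry.IsIntegral X → (∀ x : X, ∃ U : X.Opens, x ∈ U ∧
      Literature.AlgebraicGeometry.Resolution.Scheme.HasResolution
        (U : AlgebraicGeometry.Scheme.{0})) →
    (∀ W : X.Opens, AlgebraicGeometry.IsIntegral (W : AlgebraicGeometry.Scheme.{0}) →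
      ∀ U V : (W : AlgebraicGeometry.Scheme.{0}).Opens, U ⊔ V = ⊤ →
        Literature.AlgebraicGeometry.Resolution.Scheme.HasResolution
          (U : AlgebraicGeometry.Scheme.{0}) →
        Literature.AlgebraicGeometry.Resolution.Scheme.HasResolution
          (V : AlgebraicGeometry.Scheme.{0}) →
        Literature.AlgebraicGeometry.Resolution.Scheme.HasResolution
          (W : AlgebraicGeometry.Scheme.{0})) →
    Literature.AlgebraicGeometry.Resolution.Scheme.HasResolution X := by
  intro X hc hi hloc hbin
  -- Step 1: a resolvable open neighbourhood `U x` of every point `x`.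
  choose U hxU hU using hloc
  -- Step 2: binary union, iterated: every nonempty finite union of the `U x` is resolvable.
  have key : ∀ s : Finset X, s.Nonempty →
      Scheme.HasResolution ((s.sup U : X.Opens) : Scheme.{0}) := by
    intro s hsne
    induction hsne using Finset.Nonempty.cons_induction with
    | singleton a =>
      rw [Finset.sup_singleton]
      exact hU a
    | cons a t hat htne ih =>
      rw [Finset.sup_cons]
      -- the open subscheme `W = U a ∪ ⋃_{x ∈ t} U x` of `X`
      have haW : a ∈ U a ⊔ t.sup U := Opens.mem_sup.2 (Or.inl (hxU a))
      haveI : Nonempty ((U a ⊔ t.sup U : X.Opens) : Scheme.{0}) :=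
        (Scheme.Opens.nonempty_iff _).2 ⟨a, haW⟩
      haveI : IsIntegral ((U a ⊔ t.sup U : X.Opens) : Scheme.{0}) :=
        isIntegral_of_isOpenImmersion (U a ⊔ t.sup U).ι
      have hcov : (U a ⊔ t.sup U).ι ⁻¹ᵁ U a ⊔ (U a ⊔ t.sup U).ι ⁻¹ᵁ t.sup U = ⊤ := by
        rw [← Scheme.Hom.preimage_sup]
        exact (U a ⊔ t.sup U).ι_preimage_self
      exact hbin (U a ⊔ t.sup U) inferInstance _ _ hcov
        ((hU a).of_isOpenImmersion ((U a ⊔ t.sup U).ι ∣_ U a))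
        (ih.of_isOpenImmersion ((U a ⊔ t.sup U).ι ∣_ t.sup U))
  -- Step 3: quasi-compactness: finitely many of the `U x` cover `X`.
  obtain ⟨t, ht⟩ := isCompact_univ.elim_finite_subcover (fun x => ((U x : X.Opens) : Set X))
    (fun x => (U x).isOpen) (fun x _ => Set.mem_iUnion.2 ⟨x, hxU x⟩)
  have htop : t.sup U = ⊤ := by
    refine top_le_iff.mp fun z _ => ?_
    obtain ⟨i, hi, hzi⟩ := Set.mem_iUnion₂.mp (ht (Set.mem_univ z))
    exact (Finset.le_sup hi : U i ≤ t.sup U) hzi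
  -- `X` is nonempty (it is integral), so the subcover is nonempty.
  have htne : t.Nonempty := by
    obtain ⟨x₀⟩ := (inferInstance : Nonempty X)
    obtain ⟨i, hi, -⟩ := Set.mem_iUnion₂.mp (ht (Set.mem_univ x₀))
    exact ⟨i, hi⟩
  -- Step 4: the whole of `X`: `⊤ ≅ X`.
  have hres := key t htne
  rw [htop] at hres
  exact hres.of_iso X.topIso.hom

end Summit.ResolutionOfSingularities.ResolutionOfSingularities.Theorems

end
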